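import Summits.QuantumFields.YangMills.Theorems.FluctuationComparisonRegPrIntLS2BetaWhitneyHatWeights
import HarnessLib

/-!
# S2β · `hFlat` road, brick (ii-c) of UV3-NODE §57.8 — THE DISCRETE WHITNEY IDENTITY ON THE `Setup` TORUS: `d(hat lift A) = L⁻¹ · (column mean of d A)`,
# i.e. the linearised curl of the hat-weighted fine 1-form around a fine plaquette is `L⁻¹ ×` a CONVEX combination of the coarse linearised curls of its cube column

Cell `ym3-torus` (rung R3 = continuum `SU(2)` Yang–Mills on the three-torus — NOT d = 4, NOT infinite volume, NOT a mass gap, NOT Clay).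
Width seat «width 12» `ym3-torus-px12` (gen 23), FREE px helper on crux `stmt-QuantumFields-20520` (`Theses.UnitScaleTilt.FluctuationComparisonRegPrIntL`),
count-neutral, DEFINITION-FREE (weights `w` pinned by ✓`…S2BetaWhitneyHatWeights`' formula `hw`; fine form `a` pinned by `ha : a b = Σ_e w b e • A e`; the cube-column
weights `W(p, y) = χ_μ(x,y) · Π_{κ ≠ μ,ν} hat_κ(x,y) · χ_ν(x,y)` are written out in every statement).

WHY (UV3-NODE §57.2 «`QI = id + Kd`», §57.8 (R2) «flap factor `F₂`»; px12 g23 07:12:49Z locate, px8 g21 07:14:09Z (2) CONFIRMED).  The geodesic hat lift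
`V b = expPoint (a b)`, `a b = Σ_e w b e • L⁻¹ • log X e`, has fine plaquette words whose LINEAR part is the linearised curl of `a`; this file proves that part is EXACTLY
`L⁻¹ • Σ_y W(p,y) • (A⟨y,μ⟩ + A⟨y+e_μ,ν⟩ − A⟨y+e_ν,μ⟩ − A⟨y,ν⟩)` for ANY module-valued coarse 1-form `A` — the discrete analogue of «the Whitney lift commutes with `d`»
(p1 g10's ✓`UnitScaleTilt…DualWhitney3DGauge.d1_R1` is the same architecture for the signed dual profiles on `ℤ³`; here: HAT profiles, on the torus, any `d`).  With
`A = L⁻¹ • log X` the coarse curls carry another `L⁻¹`: the lift's curvature has the `L⁻²` gain of the coarse flux (companion `…S2BetaWhitneyHatLiftCurvature`).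

CONTENTS.  §1 circle: `hat_of_le`∕`hat_of_ge`, ★`hat_sub_hat_add_one` (THE STEP IDENTITY `hat(u) − hat(u+1) = L⁻¹([u.val < L] − [(u+L).val < L])` on `ℤ∕N`, `2L ≤ N`);
§2 torus bookkeeping (`shift_apply_self∕_ne`, `emb_shift_self∕_ne`, `emb_unshift_self∕_ne`: `centre(y ± e_ν)_ν = centre(y)_ν ± L`); §3 `sum_pbond_smul`, `sum_hatW_smul_eq_sum_src`,
`hatW_parallel`, `prod_erase_split`, `prod_hat_shift_eq`, `prod_hat_centre_shift_eq`, ★`hat_sub_hat_shift` (the step identity on the torus), `hatW_parallel_split`,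
★`hatW_sub_hatW_shift`, `sum_unshift_reindex`, ★★`sub_shift_hat_eq` (one direction), ★★★`lincurl_hat_eq` (THE IDENTITY); §4 `colW_nonneg`, ★`sum_colW_eq_one`, `colW_support`;
§5 ★★`norm_lincurl_hat_le` (`‖d a (p)‖ ≤ L⁻¹ · max_{column} ‖d A‖`).

HONEST SCOPE.  Finite sums and `ℤ∕N` arithmetic; nothing of Bałaban's is asserted ([Balaban1985RegularSpaces] (1.29) p.81 ∕ [Balaban1984PropagatorsI] (1.7) p.18 = printed loci
served); `hFlat`, TUBE-REG∘, GAP♯∘, S2β, crux 20520, `YM3TorusSU2` NOT proved; no registered stub closed. Refs: [Balaban1985RegularSpaces]; [Balaban1984PropagatorsI]; [Balaban1987RG1].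
-/

set_option autoImplicit false

namespace Summit.QuantumFields.YangMills.Theorems.FluctuationComparisonRegPrIntLS2BetaWhitneyHatCurl

open Finset
open Literature.MathematicalPhysics.QuantumFieldTheory.Balaban1983to89
open B10Eq27TorusAxialLog (rel rel_apply)
open Summit.QuantumFields.YangMills.Theorems.FluctuationComparisonRegPrIntLS2BetaWhitneyHatWeights
  (sum_longSel_eq_one sum_hat_eq_one two_mul_L_le_sitesPerDir emb_apply sum_hatW_eq_sum_src)

/-! ## §1 The step identity of the hat on the discrete circle -/

section Circle

variable {N L : ℕ}

/-- The hat at distance `n ≤ L` is `1 − n∕L`. [folklore] -/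
theorem hat_of_le (hL : 0 < L) {n : ℕ} (hn : n ≤ L) : max 0 (1 - ((n : ℕ) : ℝ) / L) = 1 - (n : ℝ) / L := by
  have hLr : (0 : ℝ) < L := by exact_mod_cast hL
  exact max_eq_right (by rw [sub_nonneg, div_le_one hLr]; exact_mod_cast hn)

/-- The hat at distance `n ≥ L` vanishes. [folklore] -/
theorem hat_of_ge (hL : 0 < L) {n : ℕ} (hn : L ≤ n) : max 0 (1 - ((n : ℕ) : ℝ) / L) = 0 := by
  have hLr : (0 : ℝ) < L := by exact_mod_cast hL
  exact max_eq_left (by rw [sub_nonpos, one_le_div hLr]; exact_mod_cast hn)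

/-- ★ **THE STEP IDENTITY**: one lattice step changes the hat centred at `0` by `L⁻¹ × (slab indicator − shifted slab indicator)`:
`hat(u) − hat(u+1) = L⁻¹·([u.val < L] − [(u+L).val < L])` on `ℤ∕N`, `2L ≤ N` (the discrete `d(hat) = L⁻¹·(χ_{[0,L)} − χ_{[−L,0)})`). [folklore] -/
theorem hat_sub_hat_add_one [NeZero N] (hL : 0 < L) (h2L : 2 * L ≤ N) (u : ZMod N) :
    max 0 (1 - ((u.valMinAbs.natAbs : ℕ) : ℝ) / L) - max 0 (1 - (((u + 1).valMinAbs.natAbs : ℕ) : ℝ) / L)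
      = (L : ℝ)⁻¹ * ((if u.val < L then 1 else 0) - (if (u + (L : ZMod N)).val < L then 1 else 0)) := by
  haveI : Fact (1 < N) := ⟨by omega⟩
  have hLr : (L : ℝ) ≠ 0 := by exact_mod_cast hL.ne'
  set v := u.val with hv
  have hvN : v < N := ZMod.val_lt u
  have e0 : u.valMinAbs.natAbs = min v (N - v) := ZMod.valMinAbs_natAbs_eq_min u
  have e1 : (u + 1).valMinAbs.natAbs = min ((v + 1) % N) (N - (v + 1) % N) := by
    rw [ZMod.valMinAbs_natAbs_eq_min, ZMod.val_add, ZMod.val_one]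
  have e2 : (u + (L : ZMod N)).val = (v + L) % N := by
    rw [ZMod.val_add, ZMod.val_natCast, Nat.add_mod_mod]
  rw [e0, e1, e2]
  rcases Nat.lt_or_ge v L with hA1 | hvL
  · -- rising edge of the slab: both hats on the descending branch
    have h1 : (v + 1) % N = v + 1 := Nat.mod_eq_of_lt (by omega)
    rw [h1, min_eq_left (by omega), min_eq_left (by omega), hat_of_le hL hA1.le, hat_of_le hL (by omega), if_pos hA1,
      if_neg (by rw [Nat.mod_eq_of_lt (by omega)]; omega)]
    push_cast; field_simp; ring
  rcases Nat.lt_or_ge v (N - L) with hA2 | hA3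
  · -- the flat zone: both hats vanish
    have h1 : (v + 1) % N = v + 1 := Nat.mod_eq_of_lt (by omega)
    rw [h1, hat_of_ge hL (by rw [le_min_iff]; omega), hat_of_ge hL (by rw [le_min_iff]; omega), if_neg (by omega),
      if_neg (by rw [Nat.mod_eq_of_lt (by omega)]; omega)]
    simp
  rcases Nat.lt_or_ge (v + 1) N with hB | hB
  · -- the far slab: both hats on the ascending branch
    have h1 : (v + 1) % N = v + 1 := Nat.mod_eq_of_lt hB
    have h2 : (v + L) % N = v + L - N := by
      rw [Nat.mod_eq_sub_mod (by omega), Nat.mod_eq_of_lt (by omega)]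
    rw [h1, min_eq_right (by omega), min_eq_right (by omega), hat_of_le hL (by omega), hat_of_le hL (by omega), if_neg (by omega),
      h2, if_pos (by omega)]
    rw [Nat.cast_sub (by omega), Nat.cast_sub (by omega)]
    push_cast; field_simp; ring
  · -- the corner `v = N − 1`
    have hvE : v = N - 1 := by omega
    have h1 : (v + 1) % N = 0 := by rw [show v + 1 = N by omega, Nat.mod_self]
    have h2 : (v + L) % N = L - 1 := by
      rw [Nat.mod_eq_sub_mod (by omega), Nat.mod_eq_of_lt (by omega)]; omega
    rw [h1, Nat.sub_zero, min_eq_right (by omega), min_eq_left (by omega), hat_of_le hL (by omega), hat_of_le hL (Nat.zero_le _),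
      if_neg (by omega), h2, if_pos (by omega), show N - v = 1 by omega]
    push_cast; field_simp; ring
end Circle

/-! ## §2 Torus bookkeeping: coordinates of shifted sites and of their centres -/

section Torus

variable {P : Params} {t : ℕ}

/-- `(x + e_ν)_ν = x_ν + 1`. [folklore] -/
theorem shift_apply_self {s : ℕ} (x : Site P s) (ν : Fin P.d) : (x.shift ν) ν = x ν + 1 := by
  simp [Site.shift]

/-- `(x + e_ν)_κ = x_κ` for `κ ≠ ν`. [folklore] -/
theorem shift_apply_ne {s : ℕ} (x : Site P s) {ν κ : Fin P.d} (h : κ ≠ ν) : (x.shift ν) κ = x κ := by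
  simp [Site.shift, Function.update_of_ne h]

/-- The centre of the next block in direction `ν` is `L` steps on: `centre(y + e_ν)_ν = centre(y)_ν + L` (standing range). [cite: Balaban1987RG1, (0.1) p.252] -/
theorem emb_shift_self (ht : t + 1 ≤ P.m + P.K) (y : Site P (t + 1)) (ν : Fin P.d) :
    emb (y.shift ν) ν = emb y ν + (P.L : ZMod (P.sitesPerDir t)) := by
  haveI : NeZero (P.sitesPerDir (t + 1)) := inferInstance
  have hN := P.sitesPerDir_eq_mul_succ ht
  have hN' : 0 < P.sitesPerDir (t + 1) := Nat.pos_of_ne_zero (NeZero.ne _)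
  rw [emb_apply, emb_apply, shift_apply_self,
    Summit.QuantumFields.YangMills.Theorems.FluctuationComparisonRegPrIntLS2BetaWhitneyHatWeights.centre_add hN hN', ZMod.val_one]
  push_cast; ring

/-- … and unchanged in the other coordinates. [folklore] -/
theorem emb_shift_ne {s : ℕ} (y : Site P (s + 1)) {ν κ : Fin P.d} (h : κ ≠ ν) : emb (y.shift ν) κ = emb y κ := by
  rw [emb_apply, emb_apply, shift_apply_ne y h]

/-- The centre of the previous block: `centre(y − e_ν)_ν = centre(y)_ν − L`. [cite: Balaban1987RG1, (0.1) p.252] -/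
theorem emb_unshift_self (ht : t + 1 ≤ P.m + P.K) (y : Site P (t + 1)) (ν : Fin P.d) :
    emb (y.unshift ν) ν = emb y ν - (P.L : ZMod (P.sitesPerDir t)) := by
  have h := emb_shift_self ht (y.unshift ν) ν
  rw [Site.shift_unshift] at h
  rw [h, add_sub_cancel_right]

/-- … and unchanged in the other coordinates. [folklore] -/
theorem emb_unshift_ne {s : ℕ} (y : Site P (s + 1)) {ν κ : Fin P.d} (h : κ ≠ ν) : emb (y.unshift ν) κ = emb y κ := by
  have h' := emb_shift_ne (y.unshift ν) h
  rw [Site.shift_unshift] at h'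
  exact h'.symm
end Torus

/-! ## §3 The four bonds of a fine plaquette: factorised weights -/

section Curl

variable {P : Params} {t : ℕ} {E : Type*} [AddCommGroup E] [Module ℝ E]

omit [Module ℝ E] in
/-- Sums over positively oriented bonds are sums over (initial point, direction) — module-valued edition. [folklore] -/
theorem sum_pbond_smul {s : ℕ} (f : PBond P s → E) : ∑ b, f b = ∑ x : Site P s, ∑ μ : Fin P.d, f ⟨x, μ⟩ := by
  rw [← Fintype.sum_prod_type']
  exact (Fintype.sum_equiv (⟨fun p => ⟨p.1, p.2⟩, fun b => (b.src, b.dir), fun _ => rfl, fun _ => rfl⟩ :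
    Site P s × Fin P.d ≃ PBond P s) (fun p => f ⟨p.1, p.2⟩) f fun _ => rfl).symm

/-- Only PARALLEL coarse bonds feed a fine bond: `Σ_e w b e • A e = Σ_y w b ⟨y, b.dir⟩ • A ⟨y, b.dir⟩`. [folklore] -/
theorem sum_hatW_smul_eq_sum_src (w : PBond P t → PBond P (t + 1) → ℝ)
    (hw : ∀ b e, w b e = if e.dir = b.dir ∧ (b.src b.dir - emb e.src b.dir).val < P.L then
      ∏ ν ∈ Finset.univ.erase b.dir, max 0 (1 - ((rel (emb e.src) b.src ν).natAbs : ℝ) / P.L) else 0)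
    (A : PBond P (t + 1) → E) (b : PBond P t) : ∑ e, w b e • A e = ∑ y : Site P (t + 1), w b ⟨y, b.dir⟩ • A ⟨y, b.dir⟩ := by
  rw [sum_pbond_smul]
  refine Finset.sum_congr rfl fun y _ => ?_
  rw [Finset.sum_eq_single b.dir (fun μ _ hμ => by rw [hw, if_neg (fun h => hμ h.1), zero_smul]) (fun h => absurd (Finset.mem_univ _) h)]

/-- A parallel weight is (slab indicator) × (product of the transversal hats). [folklore] -/
theorem hatW_parallel (w : PBond P t → PBond P (t + 1) → ℝ)
    (hw : ∀ b e, w b e = if e.dir = b.dir ∧ (b.src b.dir - emb e.src b.dir).val < P.L then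
      ∏ ν ∈ Finset.univ.erase b.dir, max 0 (1 - ((rel (emb e.src) b.src ν).natAbs : ℝ) / P.L) else 0)
    (x : Site P t) (μ : Fin P.d) (y : Site P (t + 1)) :
    w ⟨x, μ⟩ ⟨y, μ⟩ = (if (x μ - emb y μ).val < P.L then (1 : ℝ) else 0) *
      ∏ κ ∈ Finset.univ.erase μ, max 0 (1 - ((rel (emb y) x κ).natAbs : ℝ) / P.L) := by
  rw [hw]
  simp only [true_and]
  split_ifs <;> simp

/-- Splitting one transversal hat off the product: `Π_{κ ≠ μ} H κ = H ν · Π_{κ ≠ μ, ν} H κ` (`ν ≠ μ`). [folklore] -/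
theorem prod_erase_split {μ ν : Fin P.d} (hνμ : ν ≠ μ) (H : Fin P.d → ℝ) :
    ∏ κ ∈ Finset.univ.erase μ, H κ = H ν * ∏ κ ∈ (Finset.univ.erase μ).erase ν, H κ :=
  (Finset.mul_prod_erase (Finset.univ.erase μ) H (Finset.mem_erase.mpr ⟨hνμ, Finset.mem_univ ν⟩)).symm

/-- The hats in the directions `κ ≠ ν` do not see a step in direction `ν`. [folklore] -/
theorem prod_hat_shift_eq {μ ν : Fin P.d} (x : Site P t) (y : Site P (t + 1)) :
    ∏ κ ∈ (Finset.univ.erase μ).erase ν, max 0 (1 - ((rel (emb y) (x.shift ν) κ).natAbs : ℝ) / P.L)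
      = ∏ κ ∈ (Finset.univ.erase μ).erase ν, max 0 (1 - ((rel (emb y) x κ).natAbs : ℝ) / P.L) :=
  Finset.prod_congr rfl fun κ hκ => by rw [rel_apply, rel_apply, shift_apply_ne x (Finset.ne_of_mem_erase hκ)]

/-- … nor a shift of the CENTRE in direction `ν`. [folklore] -/
theorem prod_hat_centre_shift_eq {μ ν : Fin P.d} (x : Site P t) (y : Site P (t + 1)) :
    ∏ κ ∈ (Finset.univ.erase μ).erase ν, max 0 (1 - ((rel (emb (y.shift ν)) x κ).natAbs : ℝ) / P.L)
      = ∏ κ ∈ (Finset.univ.erase μ).erase ν, max 0 (1 - ((rel (emb y) x κ).natAbs : ℝ) / P.L) :=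
  Finset.prod_congr rfl fun κ hκ => by rw [rel_apply, rel_apply, emb_shift_ne y (Finset.ne_of_mem_erase hκ)]

/-- ★ **THE STEP IDENTITY ON THE TORUS**: the transversal hat of the centre `y`, read at `x` and at `x + e_ν`, differs by
`L⁻¹ × (slab indicator at y − slab indicator at y − e_ν)`. [folklore] -/
theorem hat_sub_hat_shift (ht : t + 1 ≤ P.m + P.K) (x : Site P t) (y : Site P (t + 1)) (ν : Fin P.d) :
    max 0 (1 - ((rel (emb y) x ν).natAbs : ℝ) / P.L) - max 0 (1 - ((rel (emb y) (x.shift ν) ν).natAbs : ℝ) / P.L)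
      = (P.L : ℝ)⁻¹ * ((if (x ν - emb y ν).val < P.L then 1 else 0) - (if (x ν - emb (y.unshift ν) ν).val < P.L then 1 else 0)) := by
  have h2L : 2 * P.L ≤ P.sitesPerDir t := by rw [P.sitesPerDir_eq_mul_succ ht]; exact two_mul_L_le_sitesPerDir P t
  rw [rel_apply, rel_apply, shift_apply_self, emb_unshift_self ht, show x ν + 1 - emb y ν = x ν - emb y ν + 1 by ring,
    show x ν - (emb y ν - (P.L : ZMod (P.sitesPerDir t))) = x ν - emb y ν + (P.L : ZMod (P.sitesPerDir t)) by ring]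
  exact hat_sub_hat_add_one P.L_pos h2L _

/-- The parallel weight with one transversal hat split off (`ν ≠ μ`). [folklore] -/
theorem hatW_parallel_split (w : PBond P t → PBond P (t + 1) → ℝ)
    (hw : ∀ b e, w b e = if e.dir = b.dir ∧ (b.src b.dir - emb e.src b.dir).val < P.L then
      ∏ ν ∈ Finset.univ.erase b.dir, max 0 (1 - ((rel (emb e.src) b.src ν).natAbs : ℝ) / P.L) else 0)
    {μ ν : Fin P.d} (hνμ : ν ≠ μ) (z : Site P t) (y : Site P (t + 1)) :
    w ⟨z, μ⟩ ⟨y, μ⟩ = (if (z μ - emb y μ).val < P.L then (1 : ℝ) else 0) *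
      (max 0 (1 - ((rel (emb y) z ν).natAbs : ℝ) / P.L) * ∏ κ ∈ (Finset.univ.erase μ).erase ν, max 0 (1 - ((rel (emb y) z κ).natAbs : ℝ) / P.L)) := by
  rw [hatW_parallel w hw, prod_erase_split hνμ]

/-- ★ **ONE STEP OF THE FINE PLAQUETTE, POINTWISE**: the weight of the parallel coarse bond over `y` seen from `x` minus the one seen from `x + e_ν` is
`L⁻¹ × χ_μ × (Π transversal hats) × (χ_ν(y) − χ_ν(y − e_ν))`. [folklore] -/
theorem hatW_sub_hatW_shift (ht : t + 1 ≤ P.m + P.K) (w : PBond P t → PBond P (t + 1) → ℝ)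
    (hw : ∀ b e, w b e = if e.dir = b.dir ∧ (b.src b.dir - emb e.src b.dir).val < P.L then
      ∏ ν ∈ Finset.univ.erase b.dir, max 0 (1 - ((rel (emb e.src) b.src ν).natAbs : ℝ) / P.L) else 0)
    {μ ν : Fin P.d} (hνμ : ν ≠ μ) (x : Site P t) (y : Site P (t + 1)) :
    w ⟨x, μ⟩ ⟨y, μ⟩ - w ⟨x.shift ν, μ⟩ ⟨y, μ⟩ = (P.L : ℝ)⁻¹ *
      ((if (x μ - emb y μ).val < P.L then (1 : ℝ) else 0) * ∏ κ ∈ (Finset.univ.erase μ).erase ν, max 0 (1 - ((rel (emb y) x κ).natAbs : ℝ) / P.L)) *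
      ((if (x ν - emb y ν).val < P.L then (1 : ℝ) else 0) - (if (x ν - emb (y.unshift ν) ν).val < P.L then 1 else 0)) := by
  have h := hat_sub_hat_shift ht x y ν
  rw [hatW_parallel_split w hw hνμ, hatW_parallel_split w hw hνμ, prod_hat_shift_eq, shift_apply_ne x hνμ.symm]
  linear_combination ((if (x μ - emb y μ).val < P.L then (1 : ℝ) else 0) *
    ∏ κ ∈ (Finset.univ.erase μ).erase ν, max 0 (1 - ((rel (emb y) x κ).natAbs : ℝ) / P.L)) * h

/-- Reindexing the `y − e_ν` terms by the shift `y ↦ y + e_ν` (a bijection of the coarse torus; the `μ`-slab and the transversal hats of the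
cube column do not see it). [folklore] -/
theorem sum_unshift_reindex (x : Site P t) {μ ν : Fin P.d} (hνμ : ν ≠ μ) (B : Site P (t + 1) → E) :
    ∑ y : Site P (t + 1), ((if (x μ - emb y μ).val < P.L then (1 : ℝ) else 0) *
        (∏ κ ∈ (Finset.univ.erase μ).erase ν, max 0 (1 - ((rel (emb y) x κ).natAbs : ℝ) / P.L)) *
        (if (x ν - emb (y.unshift ν) ν).val < P.L then (1 : ℝ) else 0)) • B y
      = ∑ y : Site P (t + 1), ((if (x μ - emb y μ).val < P.L then (1 : ℝ) else 0) *
        (∏ κ ∈ (Finset.univ.erase μ).erase ν, max 0 (1 - ((rel (emb y) x κ).natAbs : ℝ) / P.L)) *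
        (if (x ν - emb y ν).val < P.L then (1 : ℝ) else 0)) • B (y.shift ν) := by
  refine (Fintype.sum_equiv (⟨fun y => y.shift ν, fun y => y.unshift ν, fun y => Site.unshift_shift y ν, fun y => Site.shift_unshift y ν⟩ :
    Site P (t + 1) ≃ Site P (t + 1)) _ _ fun y => ?_).symm
  show _ = ((if (x μ - emb (y.shift ν) μ).val < P.L then (1 : ℝ) else 0) *
        (∏ κ ∈ (Finset.univ.erase μ).erase ν, max 0 (1 - ((rel (emb (y.shift ν)) x κ).natAbs : ℝ) / P.L)) *
        (if (x ν - emb ((y.shift ν).unshift ν) ν).val < P.L then (1 : ℝ) else 0)) • B (y.shift ν)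
  rw [Site.unshift_shift, emb_shift_ne y hνμ.symm, prod_hat_centre_shift_eq]

/-- ★★ **ONE DIRECTION OF THE FINE CURL**: `a⟨x, μ⟩ − a⟨x + e_ν, μ⟩ = L⁻¹ • Σ_y W(x,y) • (A⟨y, μ⟩ − A⟨y + e_ν, μ⟩)` with the cube-column weights
`W = χ_μ · Π_{κ ≠ μ,ν} hat_κ · χ_ν` (`ν ≠ μ`). [folklore] -/
theorem sub_shift_hat_eq (ht : t + 1 ≤ P.m + P.K) (w : PBond P t → PBond P (t + 1) → ℝ)
    (hw : ∀ b e, w b e = if e.dir = b.dir ∧ (b.src b.dir - emb e.src b.dir).val < P.L then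
      ∏ ν ∈ Finset.univ.erase b.dir, max 0 (1 - ((rel (emb e.src) b.src ν).natAbs : ℝ) / P.L) else 0)
    (A : PBond P (t + 1) → E) (a : PBond P t → E) (ha : ∀ b, a b = ∑ e, w b e • A e) (x : Site P t) {μ ν : Fin P.d} (hνμ : ν ≠ μ) :
    a ⟨x, μ⟩ - a ⟨x.shift ν, μ⟩ = (P.L : ℝ)⁻¹ • ∑ y : Site P (t + 1), ((if (x μ - emb y μ).val < P.L then (1 : ℝ) else 0) *
        (∏ κ ∈ (Finset.univ.erase μ).erase ν, max 0 (1 - ((rel (emb y) x κ).natAbs : ℝ) / P.L)) *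
        (if (x ν - emb y ν).val < P.L then (1 : ℝ) else 0)) • (A ⟨y, μ⟩ - A ⟨y.shift ν, μ⟩) := by
  rw [ha, ha, sum_hatW_smul_eq_sum_src w hw A ⟨x, μ⟩, sum_hatW_smul_eq_sum_src w hw A ⟨x.shift ν, μ⟩, ← Finset.sum_sub_distrib]
  simp only [← sub_smul]
  rw [Finset.sum_congr rfl fun y _ => by rw [hatW_sub_hatW_shift ht w hw hνμ x y]]
  simp only [mul_sub, sub_smul, Finset.sum_sub_distrib, mul_assoc, mul_smul ((P.L : ℝ)⁻¹), ← Finset.smul_sum]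
  rw [← smul_sub]
  congr 1
  simp only [← mul_assoc]
  rw [sum_unshift_reindex x hνμ fun y => A ⟨y, μ⟩, ← Finset.sum_sub_distrib]
  exact Finset.sum_congr rfl fun y _ => by rw [smul_sub]

/-- ★★★ **THE DISCRETE WHITNEY IDENTITY `d(hat lift) = hat lift(d)` ON THE `Setup` TORUS**: for the hat-weighted 1-form `a b = Σ_e w b e • A e` of ANY
coarse module-valued 1-form `A`, the linearised curl around a fine plaquette `p = (x; μ < ν)` is `L⁻¹` times a CONVEX combination — with the cube-column weights
`W(p, y) = χ_μ(x,y) · Π_{κ ≠ μ,ν} hat_κ(x,y) · χ_ν(x,y)` (`≥ 0`, `Σ_y W = 1`, §4) — of the linearised curls of `A` around the parallel coarse plaquettes `(y; μ < ν)`.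
With `A = L⁻¹ • log X` this is the `L⁻²` gain of the hat lift's curvature. [folklore] -/
theorem lincurl_hat_eq (ht : t + 1 ≤ P.m + P.K) (w : PBond P t → PBond P (t + 1) → ℝ)
    (hw : ∀ b e, w b e = if e.dir = b.dir ∧ (b.src b.dir - emb e.src b.dir).val < P.L then
      ∏ ν ∈ Finset.univ.erase b.dir, max 0 (1 - ((rel (emb e.src) b.src ν).natAbs : ℝ) / P.L) else 0)
    (A : PBond P (t + 1) → E) (a : PBond P t → E) (ha : ∀ b, a b = ∑ e, w b e • A e) (p : Plaq P t) :
    a ⟨p.src, p.μ⟩ + a ⟨p.src.shift p.μ, p.ν⟩ - a ⟨p.src.shift p.ν, p.μ⟩ - a ⟨p.src, p.ν⟩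
      = (P.L : ℝ)⁻¹ • ∑ y : Site P (t + 1), ((if (p.src p.μ - emb y p.μ).val < P.L then (1 : ℝ) else 0) *
          (∏ κ ∈ (Finset.univ.erase p.μ).erase p.ν, max 0 (1 - ((rel (emb y) p.src κ).natAbs : ℝ) / P.L)) *
          (if (p.src p.ν - emb y p.ν).val < P.L then (1 : ℝ) else 0)) •
          (A ⟨y, p.μ⟩ + A ⟨y.shift p.μ, p.ν⟩ - A ⟨y.shift p.ν, p.μ⟩ - A ⟨y, p.ν⟩) := by
  have h1 := sub_shift_hat_eq ht w hw A a ha p.src p.hμν.ne'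
  have h2 := sub_shift_hat_eq ht w hw A a ha p.src p.hμν.ne
  rw [show a ⟨p.src, p.μ⟩ + a ⟨p.src.shift p.μ, p.ν⟩ - a ⟨p.src.shift p.ν, p.μ⟩ - a ⟨p.src, p.ν⟩
      = (a ⟨p.src, p.μ⟩ - a ⟨p.src.shift p.ν, p.μ⟩) - (a ⟨p.src, p.ν⟩ - a ⟨p.src.shift p.μ, p.ν⟩) by abel, h1, h2, ← smul_sub,
    ← Finset.sum_sub_distrib]
  congr 1
  refine Finset.sum_congr rfl fun y _ => ?_
  rw [Finset.erase_right_comm (a := p.ν),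
    show (if (p.src p.ν - emb y p.ν).val < P.L then (1 : ℝ) else 0) *
        (∏ κ ∈ (Finset.univ.erase p.μ).erase p.ν, max 0 (1 - ((rel (emb y) p.src κ).natAbs : ℝ) / P.L)) *
        (if (p.src p.μ - emb y p.μ).val < P.L then (1 : ℝ) else 0)
      = (if (p.src p.μ - emb y p.μ).val < P.L then (1 : ℝ) else 0) *
        (∏ κ ∈ (Finset.univ.erase p.μ).erase p.ν, max 0 (1 - ((rel (emb y) p.src κ).natAbs : ℝ) / P.L)) *
        (if (p.src p.ν - emb y p.ν).val < P.L then (1 : ℝ) else 0) by ring, ← smul_sub]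
  congr 1
  abel

/-! ## §4 The cube-column weights: non-negative, a partition of unity, local -/

/-- `W ≥ 0`. [folklore] -/
theorem colW_nonneg (x : Site P t) (μ ν : Fin P.d) (y : Site P (t + 1)) :
    0 ≤ (if (x μ - emb y μ).val < P.L then (1 : ℝ) else 0) *
      (∏ κ ∈ (Finset.univ.erase μ).erase ν, max 0 (1 - ((rel (emb y) x κ).natAbs : ℝ) / P.L)) *
      (if (x ν - emb y ν).val < P.L then (1 : ℝ) else 0) := by
  refine mul_nonneg (mul_nonneg ?_ (Finset.prod_nonneg fun κ _ => le_max_left _ _)) ?_ <;> split_ifs <;> norm_num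

/-- ★ **`Σ_y W(x, y) = 1`**: exactly one coarse cube column carries the fine plaquette, with the transversal hats summing to one (`μ ≠ ν`, standing range).
[folklore] -/
theorem sum_colW_eq_one (ht : t + 1 ≤ P.m + P.K) (x : Site P t) {μ ν : Fin P.d} (hμν : μ ≠ ν) :
    ∑ y : Site P (t + 1), (if (x μ - emb y μ).val < P.L then (1 : ℝ) else 0) *
      (∏ κ ∈ (Finset.univ.erase μ).erase ν, max 0 (1 - ((rel (emb y) x κ).natAbs : ℝ) / P.L)) *
      (if (x ν - emb y ν).val < P.L then (1 : ℝ) else 0) = 1 := by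
  have hN := P.sitesPerDir_eq_mul_succ ht
  have hN' : 2 ≤ P.sitesPerDir (t + 1) := P.one_lt_sitesPerDir (t + 1)
  set F : Fin P.d → ZMod (P.sitesPerDir (t + 1)) → ℝ := fun κ c =>
    if κ = μ ∨ κ = ν then (if (x κ - (((c.val * P.L + (P.L - 1) / 2 : ℕ) : ZMod (P.sitesPerDir t)))).val < P.L then 1 else 0)
    else max 0 (1 - (((x κ - ((c.val * P.L + (P.L - 1) / 2 : ℕ) : ZMod (P.sitesPerDir t))).valMinAbs.natAbs : ℕ) : ℝ) / P.L) with hF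
  have hterm : ∀ y : Site P (t + 1), (if (x μ - emb y μ).val < P.L then (1 : ℝ) else 0) *
      (∏ κ ∈ (Finset.univ.erase μ).erase ν, max 0 (1 - ((rel (emb y) x κ).natAbs : ℝ) / P.L)) *
      (if (x ν - emb y ν).val < P.L then (1 : ℝ) else 0) = ∏ κ, F κ (y κ) := by
    intro y
    rw [← Finset.prod_erase_mul Finset.univ _ (Finset.mem_univ μ), prod_erase_split hμν.symm fun κ => F κ (y κ)]
    have eμ : F μ (y μ) = if (x μ - emb y μ).val < P.L then (1 : ℝ) else 0 := by rw [hF]; dsimp only; rw [if_pos (Or.inl rfl)]; rfl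
    have eν : F ν (y ν) = if (x ν - emb y ν).val < P.L then (1 : ℝ) else 0 := by rw [hF]; dsimp only; rw [if_pos (Or.inr rfl)]; rfl
    have eκ : ∀ κ ∈ (Finset.univ.erase μ).erase ν, F κ (y κ) = max 0 (1 - ((rel (emb y) x κ).natAbs : ℝ) / P.L) := by
      intro κ hκ
      have h1 : κ ≠ ν := Finset.ne_of_mem_erase hκ
      have h2 : κ ≠ μ := Finset.ne_of_mem_erase (Finset.mem_of_mem_erase hκ)
      simp only [hF, h1, h2, or_self, if_false, rel_apply, emb_apply]
    rw [eμ, eν, Finset.prod_congr rfl eκ]; ring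
  calc _ = ∑ y : Fin P.d → ZMod (P.sitesPerDir (t + 1)), ∏ κ, F κ (y κ) := Finset.sum_congr rfl fun y _ => hterm y
    _ = ∏ κ : Fin P.d, ∑ c : ZMod (P.sitesPerDir (t + 1)), F κ c := (Fintype.prod_sum F).symm
    _ = ∏ _κ : Fin P.d, (1 : ℝ) := by
        refine Finset.prod_congr rfl fun κ _ => ?_
        by_cases hκ : κ = μ ∨ κ = ν
        · simp only [hF, hκ, if_true]
          exact sum_longSel_eq_one hN (two_mul_L_le_sitesPerDir P t) (AveragingRT.half_lt P) _
        · simp only [hF, hκ, if_false]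
          exact sum_hat_eq_one hN hN' (AveragingRT.half_lt P) _
    _ = 1 := Finset.prod_const_one

/-- **LOCALITY OF `W`**: `W(x, y) ≠ 0` forces `x` into the half-open slabs of `y` in BOTH plaquette directions and within hat range transversally. [folklore] -/
theorem colW_support (ht : t + 1 ≤ P.m + P.K) {x : Site P t} {μ ν : Fin P.d} {y : Site P (t + 1)}
    (h : (if (x μ - emb y μ).val < P.L then (1 : ℝ) else 0) *
      (∏ κ ∈ (Finset.univ.erase μ).erase ν, max 0 (1 - ((rel (emb y) x κ).natAbs : ℝ) / P.L)) *
      (if (x ν - emb y ν).val < P.L then (1 : ℝ) else 0) ≠ 0) :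
    (0 ≤ rel (emb y) x μ ∧ rel (emb y) x μ < P.L) ∧ (0 ≤ rel (emb y) x ν ∧ rel (emb y) x ν < P.L) ∧
      ∀ κ, κ ≠ μ → κ ≠ ν → (rel (emb y) x κ).natAbs < P.L := by
  have hN := P.sitesPerDir_eq_mul_succ ht
  have h2L := two_mul_L_le_sitesPerDir P t
  have hsel : ∀ κ, (if (x κ - emb y κ).val < P.L then (1 : ℝ) else 0) ≠ 0 → 0 ≤ rel (emb y) x κ ∧ rel (emb y) x κ < P.L := by
    intro κ hκ
    have hlt : (x κ - emb y κ).val < P.L := by by_contra hc; exact hκ (if_neg hc)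
    have hle : (x κ - emb y κ).val ≤ P.sitesPerDir t / 2 := by rw [Nat.le_div_iff_mul_le two_pos]; omega
    rw [rel_apply, ZMod.valMinAbs_def_pos, if_pos hle]
    exact ⟨by positivity, by exact_mod_cast hlt⟩
  refine ⟨hsel μ (left_ne_zero_of_mul (left_ne_zero_of_mul h)), hsel ν (right_ne_zero_of_mul h), fun κ h1 h2 => ?_⟩
  have hfac : max 0 (1 - ((rel (emb y) x κ).natAbs : ℝ) / P.L) ≠ 0 := fun h0 =>
    right_ne_zero_of_mul (left_ne_zero_of_mul h)
      (Finset.prod_eq_zero (Finset.mem_erase.mpr ⟨h2, Finset.mem_erase.mpr ⟨h1, Finset.mem_univ κ⟩⟩) h0)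
  by_contra hge
  push Not at hge
  exact hfac (hat_of_ge P.L_pos hge)

end Curl

/-! ## §5 The norm bound: the fine curl is `L⁻¹ ×` the worst coarse curl of the column -/

section Norm

variable {P : Params} {t : ℕ} {E : Type*} [NormedAddCommGroup E] [NormedSpace ℝ E]

/-- ★★ **`‖d a (p)‖ ≤ L⁻¹ · M`** whenever every coarse plaquette of the cube column through `p` (`W ≠ 0`) has `‖d A‖ ≤ M`. [folklore] -/
theorem norm_lincurl_hat_le (ht : t + 1 ≤ P.m + P.K) (w : PBond P t → PBond P (t + 1) → ℝ)
    (hw : ∀ b e, w b e = if e.dir = b.dir ∧ (b.src b.dir - emb e.src b.dir).val < P.L then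
      ∏ ν ∈ Finset.univ.erase b.dir, max 0 (1 - ((rel (emb e.src) b.src ν).natAbs : ℝ) / P.L) else 0)
    (A : PBond P (t + 1) → E) (a : PBond P t → E) (ha : ∀ b, a b = ∑ e, w b e • A e) (p : Plaq P t) {M : ℝ}
    (hM : ∀ y : Site P (t + 1), (if (p.src p.μ - emb y p.μ).val < P.L then (1 : ℝ) else 0) *
          (∏ κ ∈ (Finset.univ.erase p.μ).erase p.ν, max 0 (1 - ((rel (emb y) p.src κ).natAbs : ℝ) / P.L)) *
          (if (p.src p.ν - emb y p.ν).val < P.L then (1 : ℝ) else 0) ≠ 0 →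
      ‖A ⟨y, p.μ⟩ + A ⟨y.shift p.μ, p.ν⟩ - A ⟨y.shift p.ν, p.μ⟩ - A ⟨y, p.ν⟩‖ ≤ M) :
    ‖a ⟨p.src, p.μ⟩ + a ⟨p.src.shift p.μ, p.ν⟩ - a ⟨p.src.shift p.ν, p.μ⟩ - a ⟨p.src, p.ν⟩‖ ≤ (P.L : ℝ)⁻¹ * M := by
  rw [lincurl_hat_eq ht w hw A a ha p, norm_smul, Real.norm_eq_abs, abs_of_nonneg (inv_nonneg.mpr (Nat.cast_nonneg _))]
  refine mul_le_mul_of_nonneg_left ?_ (inv_nonneg.mpr (Nat.cast_nonneg _))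
  refine (norm_sum_le _ _).trans ?_
  have hsum := sum_colW_eq_one ht p.src p.hμν.ne
  calc ∑ y : Site P (t + 1), ‖((if (p.src p.μ - emb y p.μ).val < P.L then (1 : ℝ) else 0) *
          (∏ κ ∈ (Finset.univ.erase p.μ).erase p.ν, max 0 (1 - ((rel (emb y) p.src κ).natAbs : ℝ) / P.L)) *
          (if (p.src p.ν - emb y p.ν).val < P.L then (1 : ℝ) else 0)) •
          (A ⟨y, p.μ⟩ + A ⟨y.shift p.μ, p.ν⟩ - A ⟨y.shift p.ν, p.μ⟩ - A ⟨y, p.ν⟩)‖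
      ≤ ∑ y : Site P (t + 1), (if (p.src p.μ - emb y p.μ).val < P.L then (1 : ℝ) else 0) *
          (∏ κ ∈ (Finset.univ.erase p.μ).erase p.ν, max 0 (1 - ((rel (emb y) p.src κ).natAbs : ℝ) / P.L)) *
          (if (p.src p.ν - emb y p.ν).val < P.L then (1 : ℝ) else 0) * M := by
        refine Finset.sum_le_sum fun y _ => ?_
        rw [norm_smul, Real.norm_eq_abs, abs_of_nonneg (colW_nonneg p.src p.μ p.ν y)]
        by_cases h0 : (if (p.src p.μ - emb y p.μ).val < P.L then (1 : ℝ) else 0) *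
            (∏ κ ∈ (Finset.univ.erase p.μ).erase p.ν, max 0 (1 - ((rel (emb y) p.src κ).natAbs : ℝ) / P.L)) *
            (if (p.src p.ν - emb y p.ν).val < P.L then (1 : ℝ) else 0) = 0
        · rw [h0, zero_mul, zero_mul]
        · exact mul_le_mul_of_nonneg_left (hM y h0) (colW_nonneg p.src p.μ p.ν y)
    _ = M := by rw [← Finset.sum_mul, hsum, one_mul]

end Norm

end Summit.QuantumFields.YangMills.Theorems.FluctuationComparisonRegPrIntLS2BetaWhitneyHatCurl
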